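import Literature.MathematicalPhysics.QuantumFieldTheory.SliceKernelLogConvex
import HarnessLib

/-!
# Hellmann–Feynman derivative kernels of the Wilson transfer kernel and the secant bracket for
# plaquette expectations — PROVED

Topic `Literature/MathematicalPhysics/QuantumFieldTheory`; companion of `SlabTransferKernel.lean`
(`sliceKernel ρ J_E J_M`), `SliceKernelLogConvex.lean` (`(J_E, J_M) ↦ log ‖T‖` is convex) and
`Literature/Analysis/OperatorTheory/PositiveKernelNormLogConvex.lean` (Kingman; the secant bracket
`log_norm_secant_bracket`; the Leibniz rule `hasDerivAt_inner_kernelOp'`). Theorems only; no definition,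
no named fact.

For the anisotropic Wilson slice kernel `K_{J_E,J_M}(a,b) = e^{J_M m(a)/2} (∫ e^{J_E q(a,E,b)} dE) e^{J_M m(b)/2}`
(`m = magSum ρ`, `q = elecSum ρ`) the derivative kernels are

* electric: `∂_{J_E} K = e^{J_M m(a)/2} (∫ e^{J_E q(a,E,b)} q(a,E,b) dE) e^{J_M m(b)/2}` — the temporal-plaquette
  insertion (`hasDerivAt_sliceKernel_elec`);
* magnetic: `∂_{J_M} K = K · (m(a) + m(b))/2` — the symmetrised spatial-plaquette insertion
  (`hasDerivAt_sliceKernel_mag`).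

Differentiating under the Haar integrals (dominated convergence; every integrand is continuous on a
compact group, `exists_abs_elecSum_le`, `exists_abs_magSum_le`) gives, for ANY family of bounded operators
`S J` on `L²(μ)` with the kernels `K_{J,J_M}` (resp. `K_{J_E,J}`) and an operator `S′` with the derivative
kernel at `J₀`, the **Hellmann–Feynman identity with frozen vectors**
`d/dJ ⟪φ, S_J ψ⟫|_{J₀} = ⟪φ, S′ ψ⟫` (`hasDerivAt_inner_sliceKernelOp_elec/_mag`), and hence, by Kingman's
convexity of `J ↦ log ‖S_J‖` and the secant bracket, the **certificate inequality**
(`log_norm_sliceKernelOp_secant_bracket_elec/_mag`): for every unit vector `ψ` with `⟪ψ, S_{β} ψ⟫ = ‖S_β‖`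
(a normalised top eigenvector — `‖S_β‖ = λ₀(β)` for the positive self-adjoint transfer operator) and
every `h > 0`,

  `(log ‖S_β‖ - log ‖S_{β-h}‖)/h ≤ ⟪ψ, S′ ψ⟫ / ‖S_β‖ ≤ (log ‖S_{β+h}‖ - log ‖S_β‖)/h`,

i.e. two secant slopes of the convex function `log λ₀` computed from (certified) values of `λ₀` at `β - h`,
`β`, `β + h` ENCLOSE the Hellmann–Feynman plaquette expectation `⟪ψ₀, (∂T) ψ₀⟫/λ₀` — with NO
differentiability of `λ₀` and NO simplicity or isolation of the top of the spectrum assumed.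

HONEST FRAMING: finite spatial torus `(ℤ/L)^d`, any compact `G`, continuous `ρ`, any real couplings; pure
operator theory — nothing about `L → ∞`, the continuum or a mass gap. (Dictionary for the Wilson action
`exp(β · ½Tr U_p)` of `SU(2)`: `J_E = β_t/2`, `J_M = β_s/2`.)

## References

* J. F. C. Kingman, Quart. J. Math. Oxford (2) 12 (1961) 283–284. [Kingman1961]
* R. M. Dudley, *Real Analysis and Probability* (2002), §6.3 Cor. 6.3.3 (one-sided difference quotients
  of convex functions). [Dudley2002]
* K. Osterwalder, E. Seiler, Ann. Phys. 110 (1978) 440, §2–3 (transfer matrix of lattice gauge theory).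
  [OsterwalderSeiler1978]
-/

noncomputable section

open MeasureTheory Set Filter Function Topology Metric
open scoped RealInnerProductSpace ENNReal

namespace Literature.MathematicalPhysics.QuantumFieldTheory

open Literature.Analysis.OperatorTheory

section HF

variable {d L : ℕ} {G : Type*} [Group G] [TopologicalSpace G] [IsTopologicalGroup G] [CompactSpace G]
  [MeasurableSpace G] [BorelSpace G] {N : ℕ} (ρ : G →* Matrix (Fin N) (Fin N) ℂ)
  [SecondCountableTopology G]

/-! ### Uniform bounds and continuity of the plaquette sums -/

omit [MeasurableSpace G] [BorelSpace G] [SecondCountableTopology G] in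
/-- `|elecSum ρ a E b| ≤ M` uniformly (continuous function on a compact space). [folklore] -/
private theorem exists_abs_elecSum_le [NeZero L] (hρ : Continuous ρ) :
    ∃ M : ℝ, ∀ (a : (Fin d → ZMod L) × Fin d → G) (E : (Fin d → ZMod L) → G)
      (b : (Fin d → ZMod L) × Fin d → G), |elecSum ρ a E b| ≤ M := by
  obtain ⟨M, hM⟩ := isCompact_univ.exists_bound_of_continuousOn
    (continuous_elecSum (d := d) (L := L) ρ hρ).continuousOn
  exact ⟨M, fun a E b => by simpa [Real.norm_eq_abs] using hM ((a, b), E) (mem_univ _)⟩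

omit [MeasurableSpace G] [BorelSpace G] [SecondCountableTopology G] in
/-- `|magSum ρ a| ≤ M` uniformly. [folklore] -/
private theorem exists_abs_magSum_le [NeZero L] (hρ : Continuous ρ) :
    ∃ M : ℝ, ∀ a : (Fin d → ZMod L) × Fin d → G, |magSum ρ a| ≤ M := by
  obtain ⟨M, hM⟩ := isCompact_univ.exists_bound_of_continuousOn
    (continuous_magSum (d := d) (L := L) ρ hρ).continuousOn
  exact ⟨M, fun a => by simpa [Real.norm_eq_abs] using hM a (mem_univ _)⟩

omit [CompactSpace G] [MeasurableSpace G] [BorelSpace G] [SecondCountableTopology G] in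
/-- `E ↦ elecSum ρ a E b` is continuous. [folklore] -/
private theorem continuous_elecSum_mid [NeZero L] (hρ : Continuous ρ)
    (a b : (Fin d → ZMod L) × Fin d → G) :
    Continuous fun E : (Fin d → ZMod L) → G => elecSum ρ a E b := by
  have hq := continuous_elecSum (d := d) (L := L) ρ hρ
  have h1 : Continuous fun E : (Fin d → ZMod L) → G =>
      (((a, b) : ((Fin d → ZMod L) × Fin d → G) × ((Fin d → ZMod L) × Fin d → G)), E) :=
    continuous_const.prodMk continuous_id
  have h2 := hq.comp h1
  simp only [Function.comp_def] at h2
  exact h2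

/-- Continuous functions on the compact temporal-link space are integrable for the Haar product.
[folklore] -/
private theorem integrable_of_continuous_links [NeZero L] {f : ((Fin d → ZMod L) → G) → ℝ}
    (hf : Continuous f) :
    Integrable f (Measure.pi fun _ : Fin d → ZMod L => haarProbability G) :=
  hf.integrable_of_hasCompactSupport
    (IsCompact.of_isClosed_subset isCompact_univ (isClosed_tsupport _) (Set.subset_univ _))

/-! ### The electric derivative: `d/dJ ∫ e^{J q} dE = ∫ e^{J q} q dE` -/

/-- **Differentiating the temporal-link integral in the electric coupling**:
`d/dJ ∫ e^{J elecSum(a,E,b)} dE |_{J₀} = ∫ e^{J₀ elecSum(a,E,b)} elecSum(a,E,b) dE` (dominated convergence on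
the compact group; majorant `M e^{(|J₀|+1)M}` on `[J₀-1, J₀+1]`). [folklore] -/
private theorem hasDerivAt_integral_exp_mul_elecSum [NeZero L] (hρ : Continuous ρ)
    (a b : (Fin d → ZMod L) × Fin d → G) (J₀ : ℝ) :
    HasDerivAt (fun J => ∫ E, Real.exp (J * elecSum ρ a E b)
        ∂(Measure.pi fun _ : Fin d → ZMod L => haarProbability G))
      (∫ E, Real.exp (J₀ * elecSum ρ a E b) * elecSum ρ a E b
        ∂(Measure.pi fun _ : Fin d → ZMod L => haarProbability G)) J₀ := by
  obtain ⟨M, hM⟩ := exists_abs_elecSum_le (d := d) (L := L) ρ hρ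
  have hq := continuous_elecSum_mid (d := d) (L := L) ρ hρ a b
  have hs : Icc (J₀ - 1) (J₀ + 1) ∈ 𝓝 J₀ := Icc_mem_nhds (by linarith) (by linarith)
  have key := hasDerivAt_integral_of_dominated_loc_of_deriv_le
    (μ := Measure.pi fun _ : Fin d → ZMod L => haarProbability G)
    (F := fun J (E : (Fin d → ZMod L) → G) => Real.exp (J * elecSum ρ a E b))
    (F' := fun J (E : (Fin d → ZMod L) → G) => Real.exp (J * elecSum ρ a E b) * elecSum ρ a E b)
    (bound := fun _ => Real.exp ((|J₀| + 1) * M) * M) hs ?_ ?_ ?_ ?_ ?_ ?_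
  · exact key.2
  · exact Eventually.of_forall fun J =>
      (Real.continuous_exp.comp (continuous_const.mul hq)).aestronglyMeasurable
  · exact integrable_of_continuous_links ((Real.continuous_exp.comp (continuous_const.mul hq)))
  · exact ((Real.continuous_exp.comp (continuous_const.mul hq)).mul hq).aestronglyMeasurable
  · refine Eventually.of_forall fun E J hJ => ?_
    have hJ' : |J| ≤ |J₀| + 1 := by
      rcases hJ with ⟨h1, h2⟩
      rw [abs_le]; constructor <;> [linarith [neg_abs_le J₀]; linarith [le_abs_self J₀]]
    have hM0 : 0 ≤ M := (abs_nonneg _).trans (hM a E b)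
    rw [norm_mul, Real.norm_eq_abs, Real.norm_eq_abs, Real.abs_exp]
    refine mul_le_mul ?_ (hM a E b) (abs_nonneg _) (Real.exp_pos _).le
    refine Real.exp_le_exp.mpr ?_
    calc J * elecSum ρ a E b ≤ |J * elecSum ρ a E b| := le_abs_self _
      _ = |J| * |elecSum ρ a E b| := abs_mul _ _
      _ ≤ (|J₀| + 1) * M := mul_le_mul hJ' (hM a E b) (abs_nonneg _) (by positivity)
  · exact integrable_const _
  · refine Eventually.of_forall fun E J _ => ?_
    exact ((hasDerivAt_mul_const (elecSum ρ a E b)).exp)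

/-! ### Derivative kernels of the slice kernel -/

/-- **Electric derivative of the slice kernel**: `∂_{J_E} sliceKernel ρ J_E J_M a b` at `J₀` equals
`e^{J_M magSum a/2} (∫ e^{J₀ elecSum} elecSum dE) e^{J_M magSum b/2}` — the temporal-plaquette insertion.
[cite: OsterwalderSeiler1978, §2–3 (transfer kernel)] -/
theorem hasDerivAt_sliceKernel_elec [NeZero L] (hρ : Continuous ρ) (JM J₀ : ℝ)
    (a b : (Fin d → ZMod L) × Fin d → G) :
    HasDerivAt (fun JE => sliceKernel ρ JE JM a b)
      (Real.exp (JM / 2 * magSum ρ a) *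
        (∫ E, Real.exp (J₀ * elecSum ρ a E b) * elecSum ρ a E b
          ∂(Measure.pi fun _ : Fin d → ZMod L => haarProbability G)) *
        Real.exp (JM / 2 * magSum ρ b)) J₀ := by
  unfold sliceKernel
  exact ((hasDerivAt_integral_exp_mul_elecSum ρ hρ a b J₀).const_mul _).mul_const _

omit [SecondCountableTopology G] in
/-- **Magnetic derivative of the slice kernel**: `∂_{J_M} sliceKernel ρ J_E J_M a b` at `J₀` equals
`sliceKernel ρ J_E J₀ a b · (magSum a + magSum b)/2` — the symmetrised spatial-plaquette insertion.
[cite: OsterwalderSeiler1978, §2–3 (transfer kernel)] -/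
theorem hasDerivAt_sliceKernel_mag [NeZero L] (JE J₀ : ℝ) (a b : (Fin d → ZMod L) × Fin d → G) :
    HasDerivAt (fun JM => sliceKernel ρ JE JM a b)
      (sliceKernel ρ JE J₀ a b * ((magSum ρ a + magSum ρ b) / 2)) J₀ := by
  set I : ℝ := ∫ E, Real.exp (JE * elecSum ρ a E b)
    ∂(Measure.pi fun _ : Fin d → ZMod L => haarProbability G) with hI
  set c : ℝ := (magSum ρ a + magSum ρ b) / 2 with hc
  have hfun : (fun JM => sliceKernel ρ JE JM a b) = fun JM => I * Real.exp (JM * c) := by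
    funext JM
    unfold sliceKernel
    rw [← hI, show JM * c = JM / 2 * magSum ρ a + JM / 2 * magSum ρ b by rw [hc]; ring, Real.exp_add]
    ring
  have hval : sliceKernel ρ JE J₀ a b = I * Real.exp (J₀ * c) := congrFun hfun J₀
  rw [hfun, hval, mul_assoc]
  exact ((hasDerivAt_mul_const c).exp).const_mul I

/-! ### Continuity (hence measurability) and uniform bounds of the kernels -/

/-- `(a, b) ↦ ∫ e^{J elecSum(a,E,b)} elecSum(a,E,b) dE` is continuous (dominated convergence on the compact
parameter space). [folklore] -/
private theorem continuous_integral_exp_mul_elecSum_mul [NeZero L] (hρ : Continuous ρ) (J : ℝ) :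
    Continuous fun p : ((Fin d → ZMod L) × Fin d → G) × ((Fin d → ZMod L) × Fin d → G) =>
      ∫ E, Real.exp (J * elecSum ρ p.1 E p.2) * elecSum ρ p.1 E p.2
        ∂(Measure.pi fun _ : Fin d → ZMod L => haarProbability G) := by
  have hq := continuous_elecSum (d := d) (L := L) ρ hρ
  have hFc : Continuous fun z : (((Fin d → ZMod L) × Fin d → G) × ((Fin d → ZMod L) × Fin d → G)) ×
      ((Fin d → ZMod L) → G) => Real.exp (J * elecSum ρ z.1.1 z.2 z.1.2) * elecSum ρ z.1.1 z.2 z.1.2 :=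
    (Real.continuous_exp.comp (continuous_const.mul hq)).mul hq
  obtain ⟨B, hB⟩ := isCompact_univ.exists_bound_of_continuousOn hFc.continuousOn
  refine continuous_of_dominated (bound := fun _ => B) (fun p => ?_) (fun p => ?_) (integrable_const B)
    (Eventually.of_forall fun E => ?_)
  · have h1 : Continuous fun E : (Fin d → ZMod L) → G => (p, E) := continuous_const.prodMk continuous_id
    have h2 := hFc.comp h1
    simp only [Function.comp_def] at h2
    exact h2.aestronglyMeasurable
  · exact Eventually.of_forall fun E => hB (p, E) (mem_univ _)
  · have h1 : Continuous fun p : ((Fin d → ZMod L) × Fin d → G) × ((Fin d → ZMod L) × Fin d → G) =>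
        (p, E) := continuous_id.prodMk continuous_const
    have h2 := hFc.comp h1
    simp only [Function.comp_def] at h2
    exact h2

/-- The electric derivative kernel is jointly continuous in `(a, b)`. [folklore] -/
private theorem continuous_elecKernel [NeZero L] (hρ : Continuous ρ) (JM J₀ : ℝ) :
    Continuous (uncurry fun (a b : (Fin d → ZMod L) × Fin d → G) =>
      Real.exp (JM / 2 * magSum ρ a) *
        (∫ E, Real.exp (J₀ * elecSum ρ a E b) * elecSum ρ a E b
          ∂(Measure.pi fun _ : Fin d → ZMod L => haarProbability G)) *
        Real.exp (JM / 2 * magSum ρ b)) := by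
  have hm := continuous_magSum (d := d) (L := L) ρ hρ
  have hI := continuous_integral_exp_mul_elecSum_mul (d := d) (L := L) ρ hρ J₀
  exact ((Real.continuous_exp.comp (continuous_const.mul (hm.comp continuous_fst))).mul hI).mul
    (Real.continuous_exp.comp (continuous_const.mul (hm.comp continuous_snd)))

/-- The magnetic derivative kernel is jointly continuous in `(a, b)`. [folklore] -/
private theorem continuous_magKernel [NeZero L] (hρ : Continuous ρ) (JE J₀ : ℝ) :
    Continuous (uncurry fun (a b : (Fin d → ZMod L) × Fin d → G) =>
      sliceKernel ρ JE J₀ a b * ((magSum ρ a + magSum ρ b) / 2)) := by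
  have hm := continuous_magSum (d := d) (L := L) ρ hρ
  have hK := continuous_sliceKernel (d := d) (L := L) ρ hρ JE J₀
  exact hK.mul (((hm.comp continuous_fst).add (hm.comp continuous_snd)).div_const _)

omit [SecondCountableTopology G] in
/-- Uniform bound for the temporal-link integrals `∫ e^{J q} dE` and `∫ e^{J q} q dE` over
`J ∈ [J₀-1, J₀+1]`. [folklore] -/
private theorem integral_exp_elecSum_bounds [NeZero L] (hρ : Continuous ρ) (J₀ : ℝ) :
    ∃ M : ℝ, 0 ≤ M ∧ ∀ J ∈ Icc (J₀ - 1) (J₀ + 1), ∀ (a b : (Fin d → ZMod L) × Fin d → G),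
      |∫ E, Real.exp (J * elecSum ρ a E b) ∂(Measure.pi fun _ : Fin d → ZMod L => haarProbability G)| ≤
          Real.exp ((|J₀| + 1) * M) ∧
        |∫ E, Real.exp (J * elecSum ρ a E b) * elecSum ρ a E b
            ∂(Measure.pi fun _ : Fin d → ZMod L => haarProbability G)| ≤
          Real.exp ((|J₀| + 1) * M) * M := by
  obtain ⟨M, hM⟩ := exists_abs_elecSum_le (d := d) (L := L) ρ hρ
  have hM0 : 0 ≤ M := (abs_nonneg _).trans (hM 1 1 1)
  refine ⟨M, hM0, fun J hJ a b => ?_⟩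
  have hJ' : |J| ≤ |J₀| + 1 := by
    rcases hJ with ⟨h1, h2⟩
    rw [abs_le]; constructor <;> [linarith [neg_abs_le J₀]; linarith [le_abs_self J₀]]
  have hexp : ∀ E, Real.exp (J * elecSum ρ a E b) ≤ Real.exp ((|J₀| + 1) * M) := fun E => by
    refine Real.exp_le_exp.mpr ?_
    calc J * elecSum ρ a E b ≤ |J * elecSum ρ a E b| := le_abs_self _
      _ = |J| * |elecSum ρ a E b| := abs_mul _ _
      _ ≤ (|J₀| + 1) * M := mul_le_mul hJ' (hM a E b) (abs_nonneg _) (by positivity)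
  constructor
  · have h := norm_integral_le_of_norm_le_const
      (μ := Measure.pi fun _ : Fin d → ZMod L => haarProbability G)
      (f := fun E => Real.exp (J * elecSum ρ a E b)) (C := Real.exp ((|J₀| + 1) * M))
      (Eventually.of_forall fun E => by rw [Real.norm_eq_abs, Real.abs_exp]; exact hexp E)
    rwa [probReal_univ, mul_one, Real.norm_eq_abs] at h
  · have h := norm_integral_le_of_norm_le_const
      (μ := Measure.pi fun _ : Fin d → ZMod L => haarProbability G)
      (f := fun E => Real.exp (J * elecSum ρ a E b) * elecSum ρ a E b)
      (C := Real.exp ((|J₀| + 1) * M) * M)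
      (Eventually.of_forall fun E => by
        rw [norm_mul, Real.norm_eq_abs, Real.norm_eq_abs, Real.abs_exp]
        exact mul_le_mul (hexp E) (hM a E b) (abs_nonneg _) (Real.exp_pos _).le)
    rwa [probReal_univ, mul_one, Real.norm_eq_abs] at h

/-! ### The Hellmann–Feynman identity with frozen vectors, and the secant bracket -/

variable {μ : Measure ((Fin d → ZMod L) × Fin d → G)} [IsFiniteMeasure μ]

/-- **Hellmann–Feynman identity, electric coupling.** Let `S J_E` be bounded operators on `L²(μ)` given
a.e. by the kernels `sliceKernel ρ J_E J_M` (`J_M` fixed) and `S′` an operator given a.e. by the electric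
derivative kernel at `J₀`. Then for all `φ, ψ ∈ L²`: `d/dJ_E ⟪φ, S_{J_E} ψ⟫ |_{J₀} = ⟪φ, S′ ψ⟫` (the vectors
are frozen; only the kernel is differentiated). [cite: OsterwalderSeiler1978, §2–3]
[cite: Dudley2002, §6.3 (with `log_norm_secant_bracket`)] -/
theorem hasDerivAt_inner_sliceKernelOp_elec [NeZero L] (hρ : Continuous ρ) (JM J₀ : ℝ)
    {S : ℝ → Lp ℝ 2 μ →L[ℝ] Lp ℝ 2 μ} {S' : Lp ℝ 2 μ →L[ℝ] Lp ℝ 2 μ}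
    (hS : ∀ JE : ℝ, ∀ φ : Lp ℝ 2 μ, (S JE φ : ((Fin d → ZMod L) × Fin d → G) → ℝ) =ᵐ[μ]
      fun a => ∫ b, sliceKernel ρ JE JM a b * φ b ∂μ)
    (hS' : ∀ φ : Lp ℝ 2 μ, (S' φ : ((Fin d → ZMod L) × Fin d → G) → ℝ) =ᵐ[μ]
      fun a => ∫ b, (Real.exp (JM / 2 * magSum ρ a) *
        (∫ E, Real.exp (J₀ * elecSum ρ a E b) * elecSum ρ a E b
          ∂(Measure.pi fun _ : Fin d → ZMod L => haarProbability G)) *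
        Real.exp (JM / 2 * magSum ρ b)) * φ b ∂μ)
    (φ ψ : Lp ℝ 2 μ) :
    HasDerivAt (fun JE => ⟪φ, S JE ψ⟫) ⟪φ, S' ψ⟫ J₀ := by
  -- the derivative-kernel family on the whole line and its uniform bound on `[J₀-1, J₀+1]`
  set K' : ℝ → ((Fin d → ZMod L) × Fin d → G) → ((Fin d → ZMod L) × Fin d → G) → ℝ :=
    fun J a b => Real.exp (JM / 2 * magSum ρ a) *
      (∫ E, Real.exp (J * elecSum ρ a E b) * elecSum ρ a E b
        ∂(Measure.pi fun _ : Fin d → ZMod L => haarProbability G)) *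
      Real.exp (JM / 2 * magSum ρ b) with hK'
  obtain ⟨M, hM0, hM⟩ := integral_exp_elecSum_bounds (d := d) (L := L) ρ hρ J₀
  obtain ⟨Mm, hMm⟩ := exists_abs_magSum_le (d := d) (L := L) ρ hρ
  have hs : Icc (J₀ - 1) (J₀ + 1) ∈ 𝓝 J₀ := Icc_mem_nhds (by linarith) (by linarith)
  have hem : ∀ a : (Fin d → ZMod L) × Fin d → G,
      |Real.exp (JM / 2 * magSum ρ a)| ≤ Real.exp (|JM| / 2 * Mm) := fun a => by
    rw [Real.abs_exp]
    refine Real.exp_le_exp.mpr ?_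
    calc JM / 2 * magSum ρ a ≤ |JM / 2 * magSum ρ a| := le_abs_self _
      _ = |JM| / 2 * |magSum ρ a| := by rw [abs_mul, abs_div, abs_two]
      _ ≤ |JM| / 2 * Mm := mul_le_mul_of_nonneg_left (hMm a) (by positivity)
  refine hasDerivAt_inner_kernelOp' (K := fun J => sliceKernel ρ J JM) (K' := K') hs
    (C := Real.exp (|JM| / 2 * Mm) * Real.exp ((|J₀| + 1) * M) * Real.exp (|JM| / 2 * Mm))
    (C' := Real.exp (|JM| / 2 * Mm) * (Real.exp ((|J₀| + 1) * M) * M) * Real.exp (|JM| / 2 * Mm))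
    (fun J _ => (continuous_sliceKernel (d := d) (L := L) ρ hρ J JM).stronglyMeasurable)
    (fun J hJ a b => ?_) ((continuous_elecKernel (d := d) (L := L) ρ hρ JM J₀).stronglyMeasurable)
    (fun J hJ a b => ?_) (fun J _ a b => hasDerivAt_sliceKernel_elec ρ hρ JM J a b) (fun J _ => hS J) hS'
    φ ψ
  · -- bound of the kernel
    rw [Real.norm_eq_abs]
    unfold sliceKernel
    rw [abs_mul, abs_mul]
    exact mul_le_mul (mul_le_mul (hem a) (hM J hJ a b).1 (abs_nonneg _) (Real.exp_pos _).le) (hem b)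
      (abs_nonneg _) (mul_nonneg (Real.exp_pos _).le (Real.exp_pos _).le)
  · -- bound of the derivative kernel
    rw [Real.norm_eq_abs, hK']
    dsimp only
    rw [abs_mul, abs_mul]
    exact mul_le_mul (mul_le_mul (hem a) (hM J hJ a b).2 (abs_nonneg _) (Real.exp_pos _).le) (hem b)
      (abs_nonneg _) (mul_nonneg (Real.exp_pos _).le (mul_nonneg (Real.exp_pos _).le hM0))

/-- **Hellmann–Feynman identity, magnetic coupling.** Let `S J_M` be bounded operators on `L²(μ)` given
a.e. by the kernels `sliceKernel ρ J_E J_M` (`J_E` fixed) and `S′` an operator given a.e. by the magnetic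
derivative kernel `sliceKernel ρ J_E J₀ a b · (magSum a + magSum b)/2`. Then
`d/dJ_M ⟪φ, S_{J_M} ψ⟫ |_{J₀} = ⟪φ, S′ ψ⟫`. [cite: OsterwalderSeiler1978, §2–3]
[cite: Dudley2002, §6.3 (with `log_norm_secant_bracket`)] -/
theorem hasDerivAt_inner_sliceKernelOp_mag [NeZero L] (hρ : Continuous ρ) (JE J₀ : ℝ)
    {S : ℝ → Lp ℝ 2 μ →L[ℝ] Lp ℝ 2 μ} {S' : Lp ℝ 2 μ →L[ℝ] Lp ℝ 2 μ}
    (hS : ∀ JM : ℝ, ∀ φ : Lp ℝ 2 μ, (S JM φ : ((Fin d → ZMod L) × Fin d → G) → ℝ) =ᵐ[μ]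
      fun a => ∫ b, sliceKernel ρ JE JM a b * φ b ∂μ)
    (hS' : ∀ φ : Lp ℝ 2 μ, (S' φ : ((Fin d → ZMod L) × Fin d → G) → ℝ) =ᵐ[μ]
      fun a => ∫ b, (sliceKernel ρ JE J₀ a b * ((magSum ρ a + magSum ρ b) / 2)) * φ b ∂μ)
    (φ ψ : Lp ℝ 2 μ) :
    HasDerivAt (fun JM => ⟪φ, S JM ψ⟫) ⟪φ, S' ψ⟫ J₀ := by
  set K' : ℝ → ((Fin d → ZMod L) × Fin d → G) → ((Fin d → ZMod L) × Fin d → G) → ℝ :=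
    fun J a b => sliceKernel ρ JE J a b * ((magSum ρ a + magSum ρ b) / 2) with hK'
  obtain ⟨M, hM0, hM⟩ := integral_exp_elecSum_bounds (d := d) (L := L) ρ hρ JE
  obtain ⟨Mm, hMm⟩ := exists_abs_magSum_le (d := d) (L := L) ρ hρ
  have hMm0 : 0 ≤ Mm := (abs_nonneg _).trans (hMm 1)
  have hs : Icc (J₀ - 1) (J₀ + 1) ∈ 𝓝 J₀ := Icc_mem_nhds (by linarith) (by linarith)
  have hem : ∀ J ∈ Icc (J₀ - 1) (J₀ + 1), ∀ a : (Fin d → ZMod L) × Fin d → G,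
      |Real.exp (J / 2 * magSum ρ a)| ≤ Real.exp ((|J₀| + 1) / 2 * Mm) := fun J hJ a => by
    have hJ' : |J| ≤ |J₀| + 1 := by
      rcases hJ with ⟨h1, h2⟩
      rw [abs_le]; constructor <;> [linarith [neg_abs_le J₀]; linarith [le_abs_self J₀]]
    rw [Real.abs_exp]
    refine Real.exp_le_exp.mpr ?_
    calc J / 2 * magSum ρ a ≤ |J / 2 * magSum ρ a| := le_abs_self _
      _ = |J| / 2 * |magSum ρ a| := by rw [abs_mul, abs_div, abs_two]
      _ ≤ (|J₀| + 1) / 2 * Mm := mul_le_mul (by linarith) (hMm a) (abs_nonneg _) (by positivity)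
  have hJE : JE ∈ Icc (JE - 1) (JE + 1) := ⟨by linarith, by linarith⟩
  have hK : ∀ J ∈ Icc (J₀ - 1) (J₀ + 1), ∀ a b : (Fin d → ZMod L) × Fin d → G,
      |sliceKernel ρ JE J a b| ≤
        Real.exp ((|J₀| + 1) / 2 * Mm) * Real.exp ((|JE| + 1) * M) * Real.exp ((|J₀| + 1) / 2 * Mm) := by
    intro J hJ a b
    unfold sliceKernel
    rw [abs_mul, abs_mul]
    exact mul_le_mul (mul_le_mul (hem J hJ a) (hM JE hJE a b).1 (abs_nonneg _) (Real.exp_pos _).le)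
      (hem J hJ b) (abs_nonneg _) (mul_nonneg (Real.exp_pos _).le (Real.exp_pos _).le)
  refine hasDerivAt_inner_kernelOp' (K := fun J => sliceKernel ρ JE J) (K' := K') hs
    (C := Real.exp ((|J₀| + 1) / 2 * Mm) * Real.exp ((|JE| + 1) * M) * Real.exp ((|J₀| + 1) / 2 * Mm))
    (C' := Real.exp ((|J₀| + 1) / 2 * Mm) * Real.exp ((|JE| + 1) * M) * Real.exp ((|J₀| + 1) / 2 * Mm) *
      Mm)
    (fun J _ => (continuous_sliceKernel (d := d) (L := L) ρ hρ JE J).stronglyMeasurable)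
    (fun J hJ a b => by rw [Real.norm_eq_abs]; exact hK J hJ a b)
    ((continuous_magKernel (d := d) (L := L) ρ hρ JE J₀).stronglyMeasurable)
    (fun J hJ a b => ?_) (fun J _ a b => hasDerivAt_sliceKernel_mag ρ JE J a b) (fun J _ => hS J) hS' φ ψ
  rw [Real.norm_eq_abs, hK']
  dsimp only
  rw [abs_mul]
  refine mul_le_mul (hK J hJ a b) ?_ (abs_nonneg _) (by positivity)
  rw [abs_div, abs_two]
  calc |magSum ρ a + magSum ρ b| / 2 ≤ (|magSum ρ a| + |magSum ρ b|) / 2 :=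
        div_le_div_of_nonneg_right (abs_add_le _ _) zero_le_two
    _ ≤ (Mm + Mm) / 2 := div_le_div_of_nonneg_right (add_le_add (hMm _) (hMm _)) zero_le_two
    _ = Mm := by ring

/-- ★ **The secant-bracket certificate for the electric (temporal-plaquette) Hellmann–Feynman value.**
`S J_E` bounded operators on `L²(μ)` (`μ ≠ 0` finite) with kernels `sliceKernel ρ J_E J_M` (`J_M` fixed),
`S′` with the electric derivative kernel at `β`, `ψ` a unit vector with `⟪ψ, S_β ψ⟫ = ‖S_β‖` (a normalised
top eigenvector; `‖S_β‖ = λ₀(β)` for the positive self-adjoint transfer operator), `h > 0`. Then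
`(log ‖S_β‖ - log ‖S_{β-h}‖)/h ≤ ⟪ψ, S′ ψ⟫/‖S_β‖ ≤ (log ‖S_{β+h}‖ - log ‖S_β‖)/h`: the two secant slopes of
the convex `J_E ↦ log ‖S_{J_E}‖` (Kingman) enclose the Hellmann–Feynman value. No differentiability of
`λ₀`, no simplicity of the top eigenvalue is assumed. [cite: Kingman1961, Theorem]
[cite: Dudley2002, §6.3 Cor. 6.3.3] -/
theorem log_norm_sliceKernelOp_secant_bracket_elec [NeZero L] (hρ : Continuous ρ) (hμ : μ ≠ 0)
    (JM β : ℝ) {h : ℝ} (hh : 0 < h)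
    {S : ℝ → Lp ℝ 2 μ →L[ℝ] Lp ℝ 2 μ} {S' : Lp ℝ 2 μ →L[ℝ] Lp ℝ 2 μ}
    (hS : ∀ JE : ℝ, ∀ φ : Lp ℝ 2 μ, (S JE φ : ((Fin d → ZMod L) × Fin d → G) → ℝ) =ᵐ[μ]
      fun a => ∫ b, sliceKernel ρ JE JM a b * φ b ∂μ)
    (hS' : ∀ φ : Lp ℝ 2 μ, (S' φ : ((Fin d → ZMod L) × Fin d → G) → ℝ) =ᵐ[μ]
      fun a => ∫ b, (Real.exp (JM / 2 * magSum ρ a) *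
        (∫ E, Real.exp (β * elecSum ρ a E b) * elecSum ρ a E b
          ∂(Measure.pi fun _ : Fin d → ZMod L => haarProbability G)) *
        Real.exp (JM / 2 * magSum ρ b)) * φ b ∂μ)
    {ψ : Lp ℝ 2 μ} (hψ : ‖ψ‖ = 1) (htop : ⟪ψ, S β ψ⟫ = ‖S β‖) :
    (Real.log ‖S β‖ - Real.log ‖S (β - h)‖) / h ≤ ⟪ψ, S' ψ⟫ / ‖S β‖ ∧
      ⟪ψ, S' ψ⟫ / ‖S β‖ ≤ (Real.log ‖S (β + h)‖ - Real.log ‖S β‖) / h := by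
  have hconv := (convexOn_log_norm_sliceKernelOp_elec (μ := μ) ρ hρ hμ JM hS).subset (subset_univ _)
    (convex_Icc (β - h) (β + h))
  have hpos : 0 < ‖S β‖ := by
    obtain ⟨C, hC⟩ := exists_sliceKernel_le (d := d) (L := L) ρ hρ β JM
    exact norm_pos_iff.mpr (kernelOp_ne_zero (continuous_sliceKernel (d := d) (L := L) ρ hρ β JM).stronglyMeasurable
      hC (sliceKernel_pos (d := d) (L := L) ρ hρ β JM) hμ (hS β))
  exact log_norm_secant_bracket S hh hconv hψ htop hpos
    (hasDerivAt_inner_sliceKernelOp_elec (μ := μ) ρ hρ JM β hS hS' ψ ψ)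

/-- ★ **The secant-bracket certificate for the magnetic (spatial-plaquette) Hellmann–Feynman value**:
as `log_norm_sliceKernelOp_secant_bracket_elec` with `J_E` fixed, `S J_M` with kernels
`sliceKernel ρ J_E J_M` and `S′` with the magnetic derivative kernel `sliceKernel ρ J_E β a b (magSum a + magSum b)/2`.
[cite: Kingman1961, Theorem] [cite: Dudley2002, §6.3 Cor. 6.3.3] -/
theorem log_norm_sliceKernelOp_secant_bracket_mag [NeZero L] (hρ : Continuous ρ) (hμ : μ ≠ 0)
    (JE β : ℝ) {h : ℝ} (hh : 0 < h)
    {S : ℝ → Lp ℝ 2 μ →L[ℝ] Lp ℝ 2 μ} {S' : Lp ℝ 2 μ →L[ℝ] Lp ℝ 2 μ}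
    (hS : ∀ JM : ℝ, ∀ φ : Lp ℝ 2 μ, (S JM φ : ((Fin d → ZMod L) × Fin d → G) → ℝ) =ᵐ[μ]
      fun a => ∫ b, sliceKernel ρ JE JM a b * φ b ∂μ)
    (hS' : ∀ φ : Lp ℝ 2 μ, (S' φ : ((Fin d → ZMod L) × Fin d → G) → ℝ) =ᵐ[μ]
      fun a => ∫ b, (sliceKernel ρ JE β a b * ((magSum ρ a + magSum ρ b) / 2)) * φ b ∂μ)
    {ψ : Lp ℝ 2 μ} (hψ : ‖ψ‖ = 1) (htop : ⟪ψ, S β ψ⟫ = ‖S β‖) :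
    (Real.log ‖S β‖ - Real.log ‖S (β - h)‖) / h ≤ ⟪ψ, S' ψ⟫ / ‖S β‖ ∧
      ⟪ψ, S' ψ⟫ / ‖S β‖ ≤ (Real.log ‖S (β + h)‖ - Real.log ‖S β‖) / h := by
  have hconv := (convexOn_log_norm_sliceKernelOp_mag (μ := μ) ρ hρ hμ JE hS).subset (subset_univ _)
    (convex_Icc (β - h) (β + h))
  have hpos : 0 < ‖S β‖ := by
    obtain ⟨C, hC⟩ := exists_sliceKernel_le (d := d) (L := L) ρ hρ JE β
    exact norm_pos_iff.mpr (kernelOp_ne_zero (continuous_sliceKernel (d := d) (L := L) ρ hρ JE β).stronglyMeasurable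
      hC (sliceKernel_pos (d := d) (L := L) ρ hρ JE β) hμ (hS β))
  exact log_norm_secant_bracket S hh hconv hψ htop hpos
    (hasDerivAt_inner_sliceKernelOp_mag (μ := μ) ρ hρ JE β hS hS' ψ ψ)

/-- ★ **Electric secant certificate, general chords** (`x₁ < x₂ ≤ β ≤ x₃ < x₄`, the form used with
several shifted couplings): `(log ‖S x₂‖ - log ‖S x₁‖)/(x₂-x₁) ≤ ⟪ψ, S′ ψ⟫/‖S β‖ ≤ (log ‖S x₄‖ - log ‖S x₃‖)/(x₄-x₃)`.
[cite: Kingman1961, Theorem] [cite: Dudley2002, §6.3 Prop. 6.3.2, Cor. 6.3.3] -/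
theorem log_norm_sliceKernelOp_secant_bracket_elec' [NeZero L] (hρ : Continuous ρ) (hμ : μ ≠ 0)
    (JM β : ℝ) {x₁ x₂ x₃ x₄ : ℝ} (h12 : x₁ < x₂) (h2 : x₂ ≤ β) (h3 : β ≤ x₃) (h34 : x₃ < x₄)
    {S : ℝ → Lp ℝ 2 μ →L[ℝ] Lp ℝ 2 μ} {S' : Lp ℝ 2 μ →L[ℝ] Lp ℝ 2 μ}
    (hS : ∀ JE : ℝ, ∀ φ : Lp ℝ 2 μ, (S JE φ : ((Fin d → ZMod L) × Fin d → G) → ℝ) =ᵐ[μ]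
      fun a => ∫ b, sliceKernel ρ JE JM a b * φ b ∂μ)
    (hS' : ∀ φ : Lp ℝ 2 μ, (S' φ : ((Fin d → ZMod L) × Fin d → G) → ℝ) =ᵐ[μ]
      fun a => ∫ b, (Real.exp (JM / 2 * magSum ρ a) *
        (∫ E, Real.exp (β * elecSum ρ a E b) * elecSum ρ a E b
          ∂(Measure.pi fun _ : Fin d → ZMod L => haarProbability G)) *
        Real.exp (JM / 2 * magSum ρ b)) * φ b ∂μ)
    {ψ : Lp ℝ 2 μ} (hψ : ‖ψ‖ = 1) (htop : ⟪ψ, S β ψ⟫ = ‖S β‖) :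
    (Real.log ‖S x₂‖ - Real.log ‖S x₁‖) / (x₂ - x₁) ≤ ⟪ψ, S' ψ⟫ / ‖S β‖ ∧
      ⟪ψ, S' ψ⟫ / ‖S β‖ ≤ (Real.log ‖S x₄‖ - Real.log ‖S x₃‖) / (x₄ - x₃) := by
  have hconv := (convexOn_log_norm_sliceKernelOp_elec (μ := μ) ρ hρ hμ JM hS).subset (subset_univ _)
    (convex_Icc x₁ x₄)
  have hpos : 0 < ‖S β‖ := by
    obtain ⟨C, hC⟩ := exists_sliceKernel_le (d := d) (L := L) ρ hρ β JM
    exact norm_pos_iff.mpr (kernelOp_ne_zero (continuous_sliceKernel (d := d) (L := L) ρ hρ β JM).stronglyMeasurable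
      hC (sliceKernel_pos (d := d) (L := L) ρ hρ β JM) hμ (hS β))
  exact log_norm_secant_bracket' S h12 h2 h3 h34 hconv hψ htop hpos
    (hasDerivAt_inner_sliceKernelOp_elec (μ := μ) ρ hρ JM β hS hS' ψ ψ)

/-- ★ **Magnetic secant certificate, general chords** (`x₁ < x₂ ≤ β ≤ x₃ < x₄`).
[cite: Kingman1961, Theorem] [cite: Dudley2002, §6.3 Prop. 6.3.2, Cor. 6.3.3] -/
theorem log_norm_sliceKernelOp_secant_bracket_mag' [NeZero L] (hρ : Continuous ρ) (hμ : μ ≠ 0)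
    (JE β : ℝ) {x₁ x₂ x₃ x₄ : ℝ} (h12 : x₁ < x₂) (h2 : x₂ ≤ β) (h3 : β ≤ x₃) (h34 : x₃ < x₄)
    {S : ℝ → Lp ℝ 2 μ →L[ℝ] Lp ℝ 2 μ} {S' : Lp ℝ 2 μ →L[ℝ] Lp ℝ 2 μ}
    (hS : ∀ JM : ℝ, ∀ φ : Lp ℝ 2 μ, (S JM φ : ((Fin d → ZMod L) × Fin d → G) → ℝ) =ᵐ[μ]
      fun a => ∫ b, sliceKernel ρ JE JM a b * φ b ∂μ)
    (hS' : ∀ φ : Lp ℝ 2 μ, (S' φ : ((Fin d → ZMod L) × Fin d → G) → ℝ) =ᵐ[μ]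
      fun a => ∫ b, (sliceKernel ρ JE β a b * ((magSum ρ a + magSum ρ b) / 2)) * φ b ∂μ)
    {ψ : Lp ℝ 2 μ} (hψ : ‖ψ‖ = 1) (htop : ⟪ψ, S β ψ⟫ = ‖S β‖) :
    (Real.log ‖S x₂‖ - Real.log ‖S x₁‖) / (x₂ - x₁) ≤ ⟪ψ, S' ψ⟫ / ‖S β‖ ∧
      ⟪ψ, S' ψ⟫ / ‖S β‖ ≤ (Real.log ‖S x₄‖ - Real.log ‖S x₃‖) / (x₄ - x₃) := by
  have hconv := (convexOn_log_norm_sliceKernelOp_mag (μ := μ) ρ hρ hμ JE hS).subset (subset_univ _)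
    (convex_Icc x₁ x₄)
  have hpos : 0 < ‖S β‖ := by
    obtain ⟨C, hC⟩ := exists_sliceKernel_le (d := d) (L := L) ρ hρ JE β
    exact norm_pos_iff.mpr (kernelOp_ne_zero (continuous_sliceKernel (d := d) (L := L) ρ hρ JE β).stronglyMeasurable
      hC (sliceKernel_pos (d := d) (L := L) ρ hρ JE β) hμ (hS β))
  exact log_norm_secant_bracket' S h12 h2 h3 h34 hconv hψ htop hpos
    (hasDerivAt_inner_sliceKernelOp_mag (μ := μ) ρ hρ JE β hS hS' ψ ψ)

/-! ### Operator-free forms: the Hellmann–Feynman numerator as an explicit double integral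

For consumers who have the family `S` but no operator for the derivative kernel: the same statements with
`⟪φ, S′ ψ⟫` replaced by `∫ φ(a) K′(a,b) ψ(b) d(μ ⊗ μ)`, and the existence of the derivative-kernel operators. -/

/-- **Existence of the electric derivative-kernel operator** (bounded jointly continuous kernel on a finite
measure space; `exists_kernelOp`). [cite: OsterwalderSeiler1978, §2–3] -/
theorem exists_sliceKernelElecOp [NeZero L] (hρ : Continuous ρ) (JM J₀ : ℝ) :
    ∃ S' : Lp ℝ 2 μ →L[ℝ] Lp ℝ 2 μ, ∀ φ : Lp ℝ 2 μ, (S' φ : ((Fin d → ZMod L) × Fin d → G) → ℝ) =ᵐ[μ]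
      fun a => ∫ b, (Real.exp (JM / 2 * magSum ρ a) *
        (∫ E, Real.exp (J₀ * elecSum ρ a E b) * elecSum ρ a E b
          ∂(Measure.pi fun _ : Fin d → ZMod L => haarProbability G)) *
        Real.exp (JM / 2 * magSum ρ b)) * φ b ∂μ := by
  have hc := continuous_elecKernel (d := d) (L := L) ρ hρ JM J₀
  obtain ⟨C, hC⟩ := isCompact_univ.exists_bound_of_continuousOn hc.continuousOn
  exact exists_kernelOp hc.stronglyMeasurable (C := C) (fun a b => hC (a, b) (mem_univ _))

/-- **Existence of the magnetic derivative-kernel operator.** [cite: OsterwalderSeiler1978, §2–3] -/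
theorem exists_sliceKernelMagOp [NeZero L] (hρ : Continuous ρ) (JE J₀ : ℝ) :
    ∃ S' : Lp ℝ 2 μ →L[ℝ] Lp ℝ 2 μ, ∀ φ : Lp ℝ 2 μ, (S' φ : ((Fin d → ZMod L) × Fin d → G) → ℝ) =ᵐ[μ]
      fun a => ∫ b, (sliceKernel ρ JE J₀ a b * ((magSum ρ a + magSum ρ b) / 2)) * φ b ∂μ := by
  have hc := continuous_magKernel (d := d) (L := L) ρ hρ JE J₀
  obtain ⟨C, hC⟩ := isCompact_univ.exists_bound_of_continuousOn hc.continuousOn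
  exact exists_kernelOp hc.stronglyMeasurable (C := C) (fun a b => hC (a, b) (mem_univ _))

/-- ★ **Electric secant certificate, operator-free form**: with `S J_E` the kernel operators of
`sliceKernel ρ J_E J_M` and `ψ` a unit top vector of `S β`, for `x₁ < x₂ ≤ β ≤ x₃ < x₄` the chords of
`log ‖S ·‖` enclose the Hellmann–Feynman numerator written as the explicit double integral
`∫ ψ(a) [e^{J_M m(a)/2} (∫ e^{β q(a,E,b)} q(a,E,b) dE) e^{J_M m(b)/2}] ψ(b) d(μ⊗μ)` divided by `‖S β‖`.
[cite: Kingman1961, Theorem] [cite: Dudley2002, §6.3 Prop. 6.3.2, Cor. 6.3.3] -/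
theorem log_norm_sliceKernelOp_secant_bracket_elec_integral [NeZero L] (hρ : Continuous ρ) (hμ : μ ≠ 0)
    (JM β : ℝ) {x₁ x₂ x₃ x₄ : ℝ} (h12 : x₁ < x₂) (h2 : x₂ ≤ β) (h3 : β ≤ x₃) (h34 : x₃ < x₄)
    {S : ℝ → Lp ℝ 2 μ →L[ℝ] Lp ℝ 2 μ}
    (hS : ∀ JE : ℝ, ∀ φ : Lp ℝ 2 μ, (S JE φ : ((Fin d → ZMod L) × Fin d → G) → ℝ) =ᵐ[μ]
      fun a => ∫ b, sliceKernel ρ JE JM a b * φ b ∂μ)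
    {ψ : Lp ℝ 2 μ} (hψ : ‖ψ‖ = 1) (htop : ⟪ψ, S β ψ⟫ = ‖S β‖) :
    (Real.log ‖S x₂‖ - Real.log ‖S x₁‖) / (x₂ - x₁) ≤
        (∫ z, ψ z.1 * ((Real.exp (JM / 2 * magSum ρ z.1) *
          (∫ E, Real.exp (β * elecSum ρ z.1 E z.2) * elecSum ρ z.1 E z.2
            ∂(Measure.pi fun _ : Fin d → ZMod L => haarProbability G)) *
          Real.exp (JM / 2 * magSum ρ z.2)) * ψ z.2) ∂(μ.prod μ)) / ‖S β‖ ∧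
      (∫ z, ψ z.1 * ((Real.exp (JM / 2 * magSum ρ z.1) *
          (∫ E, Real.exp (β * elecSum ρ z.1 E z.2) * elecSum ρ z.1 E z.2
            ∂(Measure.pi fun _ : Fin d → ZMod L => haarProbability G)) *
          Real.exp (JM / 2 * magSum ρ z.2)) * ψ z.2) ∂(μ.prod μ)) / ‖S β‖ ≤
        (Real.log ‖S x₄‖ - Real.log ‖S x₃‖) / (x₄ - x₃) := by
  obtain ⟨S', hS'⟩ := exists_sliceKernelElecOp (μ := μ) ρ hρ JM β
  have key := log_norm_sliceKernelOp_secant_bracket_elec' (μ := μ) ρ hρ hμ JM β h12 h2 h3 h34 hS hS' hψ htop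
  have hc := continuous_elecKernel (d := d) (L := L) ρ hρ JM β
  obtain ⟨C, hC⟩ := isCompact_univ.exists_bound_of_continuousOn hc.continuousOn
  have hform := inner_kernelOp_eq_integral hS' ψ ψ
  rw [integral_prod _ (integrable_mul_kernel_mul hc.stronglyMeasurable (fun a b => hC (a, b) (mem_univ _))
    ψ ψ)] 
  have e : ⟪ψ, S' ψ⟫ = ∫ x, ∫ y, ψ (x, y).1 * ((Real.exp (JM / 2 * magSum ρ (x, y).1) *
      (∫ E, Real.exp (β * elecSum ρ (x, y).1 E (x, y).2) * elecSum ρ (x, y).1 E (x, y).2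
        ∂(Measure.pi fun _ : Fin d → ZMod L => haarProbability G)) *
      Real.exp (JM / 2 * magSum ρ (x, y).2)) * ψ (x, y).2) ∂μ ∂μ := by
    rw [hform]
    refine integral_congr_ae (Eventually.of_forall fun x => ?_)
    exact (integral_const_mul (ψ x) _).symm
  rw [← e]
  exact key

/-! ### Monotonicity of the Hellmann–Feynman plaquette values in their own coupling -/

/-- ★ **The electric Hellmann–Feynman value is non-decreasing in the electric coupling**: for `β₁ < β₂`,
`S J_E` the kernel operators of `sliceKernel ρ J_E J_M`, `S′ᵢ` the electric derivative-kernel operators at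
`βᵢ` and `ψᵢ` unit top vectors of `S βᵢ`: `⟪ψ₁, S′₁ ψ₁⟫/‖S β₁‖ ≤ ⟪ψ₂, S′₂ ψ₂⟫/‖S β₂‖` (convexity of
`J_E ↦ log ‖S_{J_E}‖`; the `L_t = ∞` analogue of `d⟨P_t⟩/dβ_t = Var ≥ 0`).
[cite: Kingman1961, Theorem] [cite: Dudley2002, §6.3 Cor. 6.3.3] -/
theorem inner_sliceKernelElecOp_div_norm_mono [NeZero L] (hρ : Continuous ρ) (hμ : μ ≠ 0)
    (JM : ℝ) {β₁ β₂ : ℝ} (hβ : β₁ < β₂)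
    {S : ℝ → Lp ℝ 2 μ →L[ℝ] Lp ℝ 2 μ} {S₁' S₂' : Lp ℝ 2 μ →L[ℝ] Lp ℝ 2 μ}
    (hS : ∀ JE : ℝ, ∀ φ : Lp ℝ 2 μ, (S JE φ : ((Fin d → ZMod L) × Fin d → G) → ℝ) =ᵐ[μ]
      fun a => ∫ b, sliceKernel ρ JE JM a b * φ b ∂μ)
    (hS₁' : ∀ φ : Lp ℝ 2 μ, (S₁' φ : ((Fin d → ZMod L) × Fin d → G) → ℝ) =ᵐ[μ]
      fun a => ∫ b, (Real.exp (JM / 2 * magSum ρ a) *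
        (∫ E, Real.exp (β₁ * elecSum ρ a E b) * elecSum ρ a E b
          ∂(Measure.pi fun _ : Fin d → ZMod L => haarProbability G)) *
        Real.exp (JM / 2 * magSum ρ b)) * φ b ∂μ)
    (hS₂' : ∀ φ : Lp ℝ 2 μ, (S₂' φ : ((Fin d → ZMod L) × Fin d → G) → ℝ) =ᵐ[μ]
      fun a => ∫ b, (Real.exp (JM / 2 * magSum ρ a) *
        (∫ E, Real.exp (β₂ * elecSum ρ a E b) * elecSum ρ a E b
          ∂(Measure.pi fun _ : Fin d → ZMod L => haarProbability G)) *
        Real.exp (JM / 2 * magSum ρ b)) * φ b ∂μ)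
    {ψ₁ ψ₂ : Lp ℝ 2 μ} (hψ₁ : ‖ψ₁‖ = 1) (hψ₂ : ‖ψ₂‖ = 1)
    (htop₁ : ⟪ψ₁, S β₁ ψ₁⟫ = ‖S β₁‖) (htop₂ : ⟪ψ₂, S β₂ ψ₂⟫ = ‖S β₂‖) :
    ⟪ψ₁, S₁' ψ₁⟫ / ‖S β₁‖ ≤ ⟪ψ₂, S₂' ψ₂⟫ / ‖S β₂‖ := by
  have hconv := (convexOn_log_norm_sliceKernelOp_elec (μ := μ) ρ hρ hμ JM hS).subset (subset_univ _)
    (convex_Icc β₁ β₂)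
  have hpos : ∀ β : ℝ, 0 < ‖S β‖ := fun β => by
    obtain ⟨C, hC⟩ := exists_sliceKernel_le (d := d) (L := L) ρ hρ β JM
    exact norm_pos_iff.mpr (kernelOp_ne_zero (continuous_sliceKernel (d := d) (L := L) ρ hρ β JM).stronglyMeasurable
      hC (sliceKernel_pos (d := d) (L := L) ρ hρ β JM) hμ (hS β))
  have h := log_norm_hasDerivAt_div_mono S hβ hconv hψ₁ hψ₂ htop₁ htop₂ (hpos β₁) (hpos β₂)
    (hasDerivAt_inner_sliceKernelOp_elec (μ := μ) ρ hρ JM β₁ hS hS₁' ψ₁ ψ₁)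
    (hasDerivAt_inner_sliceKernelOp_elec (μ := μ) ρ hρ JM β₂ hS hS₂' ψ₂ ψ₂)
  exact h.1.trans h.2

/-- ★ **The magnetic Hellmann–Feynman value is non-decreasing in the magnetic coupling** (as
`inner_sliceKernelElecOp_div_norm_mono`, with `J_E` fixed and the magnetic derivative kernels).
[cite: Kingman1961, Theorem] [cite: Dudley2002, §6.3 Cor. 6.3.3] -/
theorem inner_sliceKernelMagOp_div_norm_mono [NeZero L] (hρ : Continuous ρ) (hμ : μ ≠ 0)
    (JE : ℝ) {β₁ β₂ : ℝ} (hβ : β₁ < β₂)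
    {S : ℝ → Lp ℝ 2 μ →L[ℝ] Lp ℝ 2 μ} {S₁' S₂' : Lp ℝ 2 μ →L[ℝ] Lp ℝ 2 μ}
    (hS : ∀ JM : ℝ, ∀ φ : Lp ℝ 2 μ, (S JM φ : ((Fin d → ZMod L) × Fin d → G) → ℝ) =ᵐ[μ]
      fun a => ∫ b, sliceKernel ρ JE JM a b * φ b ∂μ)
    (hS₁' : ∀ φ : Lp ℝ 2 μ, (S₁' φ : ((Fin d → ZMod L) × Fin d → G) → ℝ) =ᵐ[μ]
      fun a => ∫ b, (sliceKernel ρ JE β₁ a b * ((magSum ρ a + magSum ρ b) / 2)) * φ b ∂μ)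
    (hS₂' : ∀ φ : Lp ℝ 2 μ, (S₂' φ : ((Fin d → ZMod L) × Fin d → G) → ℝ) =ᵐ[μ]
      fun a => ∫ b, (sliceKernel ρ JE β₂ a b * ((magSum ρ a + magSum ρ b) / 2)) * φ b ∂μ)
    {ψ₁ ψ₂ : Lp ℝ 2 μ} (hψ₁ : ‖ψ₁‖ = 1) (hψ₂ : ‖ψ₂‖ = 1)
    (htop₁ : ⟪ψ₁, S β₁ ψ₁⟫ = ‖S β₁‖) (htop₂ : ⟪ψ₂, S β₂ ψ₂⟫ = ‖S β₂‖) :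
    ⟪ψ₁, S₁' ψ₁⟫ / ‖S β₁‖ ≤ ⟪ψ₂, S₂' ψ₂⟫ / ‖S β₂‖ := by
  have hconv := (convexOn_log_norm_sliceKernelOp_mag (μ := μ) ρ hρ hμ JE hS).subset (subset_univ _)
    (convex_Icc β₁ β₂)
  have hpos : ∀ β : ℝ, 0 < ‖S β‖ := fun β => by
    obtain ⟨C, hC⟩ := exists_sliceKernel_le (d := d) (L := L) ρ hρ JE β
    exact norm_pos_iff.mpr (kernelOp_ne_zero (continuous_sliceKernel (d := d) (L := L) ρ hρ JE β).stronglyMeasurable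
      hC (sliceKernel_pos (d := d) (L := L) ρ hρ JE β) hμ (hS β))
  have h := log_norm_hasDerivAt_div_mono S hβ hconv hψ₁ hψ₂ htop₁ htop₂ (hpos β₁) (hpos β₂)
    (hasDerivAt_inner_sliceKernelOp_mag (μ := μ) ρ hρ JE β₁ hS hS₁' ψ₁ ψ₁)
    (hasDerivAt_inner_sliceKernelOp_mag (μ := μ) ρ hρ JE β₂ hS hS₂' ψ₂ ψ₂)
  exact h.1.trans h.2

end HF

end Literature.MathematicalPhysics.QuantumFieldTheory

end
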